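import Summits.AtomisticToContinuum.Crystallization.Theorems.ExcessDecayLiouvilleLinearSupCrossBound

/-!
# Route `ExcessDecayLiouville`: the pointwise bounds applied to a balanced field (linear levels, VIII)

Linear half of the harmonic-replacement architecture for item `ExcessDecay` (stmt-AtomisticToContinuum-9334).
For a finitely supported `h` whose operator rows on `dist · c₀ ≤ ρ_h` equal a sublattice-constant field `Gf`,
and which is BALANCED at the level-one radius `R₁ = 1280r' + 2388` (the level-one work term
`Σ' η₁² ⟪Gf, h⟫` is `≤ 0`), the forward differences `Δ_τ h` have zero rows, and the pointwise bounds of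
`ExcessDecayLiouvilleLinearSup` / `…LinearSupCrossBound` give, on `S ∩ B_{r'}(c₀)`:

* `mass_grad_le` : `M(Δ_τ h; R₁) ≤ L [ M(h; 4R₁+4)/R₁² + J_Y(h) ]` (level one with the balance);
* `sup_grad_sq_le` : `‖Δ_τ h(x₀)‖² ≤ Θ₁`;
* `sup_hess_sq_le` : `‖Δ_σ Δ_τ h(x₀)‖² ≤ Θ₂`;
* `sup_cross_sq_le` : `‖Δ_τ h(x₀) − Δ_τ h(x₀ + (t 1 − t 0))‖² ≤ Θ₂` (`x₀` on sublattice `0`),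

with `Y = 10r'+10`, `Γ = L [ M(h; 4R₁+4)/R₁² + J_Y(h) ]`, `JΔ = Σ_e J_Y(Δ_e h)`,
`Θ₁ = 64L³Γ/r'³ + 536L³r'³ JΔ`, `Θ₂ = 64L⁴Γ/r'⁵ + (64L⁴/r'³ + 3216L⁴r'³) JΔ`.

All `[folklore]`; helper lemmas, nothing here closes an item.
-/

noncomputable section

namespace Summit.AtomisticToContinuum.Crystallization.Theorems.ExcessDecayLiouville

open scoped BigOperators Topology InnerProductSpace RealInnerProductSpace Classical
open Literature.MathematicalPhysics.StatisticalMechanics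
open Summit.AtomisticToContinuum.Crystallization.Theorems.PhononStabilityNegative

-- Local notation: the force-constant map `K(e)w = h(|e|²)w + 2⟪e,w⟫h′(|e|²)e`.
local notation3 "𝕂[" e "] " w:max =>
  (-((‖e‖ ^ 2)⁻¹) ^ 7 + ((‖e‖ ^ 2)⁻¹) ^ 4) • w + (2 * ⟪e, w⟫ * (7 * ((‖e‖ ^ 2)⁻¹) ^ 8 - 4 * ((‖e‖ ^ 2)⁻¹) ^ 5)) • e
set_option quotPrecheck false in
local notation "𝟙ᵇ[" x ", " c ", " R "]" => (if dist (x : EuclideanSpace ℝ (Fin 3)) c ≤ R then (1 : ℝ) else 0)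
-- the three forward generators of `Λ₀`
local notation "𝐮₁" => (triangularVec₁ 1 : EuclideanSpace ℝ (Fin 3))
local notation "𝐮₂" => (triangularVec₂ 1 : EuclideanSpace ℝ (Fin 3))
local notation "𝐰₃" => (layerNormal (2 * Real.sqrt (2 / 3)) : EuclideanSpace ℝ (Fin 3))
-- the constants of one level in mass form
local notation "Cₐ" => (19 * (1024 / ((23 / 25 : ℝ) ^ 3 * (23 / 25 : ℝ) ^ 3)) + 38 * (1024 / (23 / 25 : ℝ) ^ 3))
local notation "Cⱼ" => (9961472 : ℝ)

section

variable {t : Fin 2 → (EuclideanSpace ℝ (Fin 3))} {A : (EuclideanSpace ℝ (Fin 3)) →L[ℝ] (EuclideanSpace ℝ (Fin 3))}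
  {c₀ : EuclideanSpace ℝ (Fin 3)} {κ : ℝ}

set_option quotPrecheck false in
-- Local notation: the operator row `(L v)(p)`.
local notation "𝕃" v:max " @ " p:max =>
  tsum (fun q : Sites₀ t A => (if ((p : Sites₀ t A) : EuclideanSpace ℝ (Fin 3)) ≠ q then
    𝕂[((p : Sites₀ t A) : EuclideanSpace ℝ (Fin 3)) - q] (v ((p : Sites₀ t A) : EuclideanSpace ℝ (Fin 3)) - v q) else 0))
set_option quotPrecheck false in
-- local mass on the ball of radius `X` about the section centre `c₀`
local notation "𝐌[" f ", " X "]" =>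
  tsum (fun p : Sites₀ t A => ‖f (p : EuclideanSpace ℝ (Fin 3))‖ ^ 2 * 𝟙ᵇ[p, c₀, X])
set_option quotPrecheck false in
-- weighted far mass with floor `Y` about `c₀`
local notation "𝐉[" f ", " Y "]" =>
  tsum (fun q : Sites₀ t A => ‖f (q : EuclideanSpace ℝ (Fin 3))‖ ^ 2 * (max (dist (q : EuclideanSpace ℝ (Fin 3)) c₀) Y)⁻¹ ^ 8)
set_option quotPrecheck false in
-- lattice difference
local notation "Δ[" τ "] " f:max => (fun x : EuclideanSpace ℝ (Fin 3) => f (x + A τ) - f x)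
set_option quotPrecheck false in
-- the level constant `L = (4Cₐ + 24Cⱼ)/κ + 1`
local notation "𝐋" => ((4 * Cₐ + 24 * Cⱼ) / κ + 1)
set_option quotPrecheck false in
-- the level-one work term at radius `R₁` (radial site cutoff at radii `R₁ + 2`, `2R₁ + 2`)
local notation "𝐖[" Gf ", " h ", " R₁ "]" =>
  tsum (fun p : Sites₀ t A => (if (p : EuclideanSpace ℝ (Fin 3)) ∈ Sites₀ t A then
    max (min 1 ((R₁ + 2 + R₁ - dist (p : EuclideanSpace ℝ (Fin 3)) c₀) / R₁)) 0 else 0) ^ 2 *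
      ⟪Gf (p : EuclideanSpace ℝ (Fin 3)), h (p : EuclideanSpace ℝ (Fin 3))⟫)
set_option quotPrecheck false in
-- the gradient far mass
local notation "𝐉Δ[" h ", " Y "]" => (𝐉[Δ[𝐮₁] h, Y] + 𝐉[Δ[𝐮₂] h, Y] + 𝐉[Δ[𝐰₃] h, Y])

/-! ## Level one with the balance -/

/-- Differences of a field whose operator rows are a sublattice-constant field have ZERO rows
(radius loss `2`). [folklore] -/
theorem harm_diff_of_rows (hA : Adm₀ A) (hI : Inner₀ t A) {h : (EuclideanSpace ℝ (Fin 3)) → (EuclideanSpace ℝ (Fin 3))}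
    (hh : (Function.support h).Finite) {τ : EuclideanSpace ℝ (Fin 3)} (hτ : τ ∈ Λ₀) (hτ2 : ‖A τ‖ ≤ 2)
    {Gf : (EuclideanSpace ℝ (Fin 3)) → (EuclideanSpace ℝ (Fin 3))}
    (hG : ∀ (p : Sites₀ t A) (l : EuclideanSpace ℝ (Fin 3)), l ∈ Λ₀ → Gf ((p : EuclideanSpace ℝ (Fin 3)) + A l) = Gf p)
    {ρh : ℝ} (hrows : ∀ p : Sites₀ t A, dist (p : EuclideanSpace ℝ (Fin 3)) c₀ ≤ ρh → 𝕃 h @ p = Gf p) :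
    ∀ p : Sites₀ t A, dist (p : EuclideanSpace ℝ (Fin 3)) c₀ ≤ ρh - 2 → 𝕃 (Δ[τ] h) @ p = 0 := by
  obtain ⟨B, hB⟩ := exists_norm_le_of_finite hh
  intro p hp
  exact harm_translate_sub hA hI hB hτ hτ2 (fun q => hG q τ hτ) hrows p hp

/-- **Level one with the balance**: for a forward generator `τ`, `1 ≤ R₁`, `2R₁ + 2 ≤ ρ_h`, `0 < Y ≤ 2R₁+2` and the
work term `W ≤ 0`: `M(Δ_τ h; R₁) ≤ L [ M(h; 4R₁+4)/R₁² + J_Y(h) ]`. [folklore] -/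
theorem mass_grad_le (hA : Adm₀ A) (hI : Inner₀ t A) (hκ0 : 0 < κ)
    (hκ : ∀ v : (EuclideanSpace ℝ (Fin 3)) → (EuclideanSpace ℝ (Fin 3)), (Function.support v).Finite →
      Function.support v ⊆ Sites₀ t A → κ * nnForm t A v ≤ ∑' p : Sites₀ t A, ⟪𝕃 v @ p, v p⟫)
    {h : (EuclideanSpace ℝ (Fin 3)) → (EuclideanSpace ℝ (Fin 3))} (hh : (Function.support h).Finite)
    {R₁ : ℝ} (hR₁ : 1 ≤ R₁) {ρh : ℝ} (hρh : 2 * R₁ + 2 ≤ ρh)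
    {Gf : (EuclideanSpace ℝ (Fin 3)) → (EuclideanSpace ℝ (Fin 3))}
    (hrows : ∀ p : Sites₀ t A, dist (p : EuclideanSpace ℝ (Fin 3)) c₀ ≤ ρh → 𝕃 h @ p = Gf p)
    (hwork : 𝐖[Gf, h, R₁] ≤ 0) {τ : EuclideanSpace ℝ (Fin 3)} (hτ : τ = 𝐮₁ ∨ τ = 𝐮₂ ∨ τ = 𝐰₃)
    {Y : ℝ} (hY : 0 < Y) (hYR : Y ≤ 2 * R₁ + 2) :
    𝐌[Δ[τ] h, R₁] ≤ 𝐋 * (𝐌[h, 4 * R₁ + 4] / R₁ ^ 2 + 𝐉[h, Y]) := by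
  obtain ⟨hτΛ, hτ2⟩ := gen_mem hA hτ
  have key := mass_diff_le_work hA hI hκ0.le hκ hh hR₁ hρh hrows hτΛ hτ2 (Mτ := 4) (by norm_num) (dom_gen hA hI hτ)
    hY hYR
  obtain ⟨hL1, hLa, hLj, -⟩ := levelConst_le (κ := κ) hκ0
  have hM0 : 0 ≤ 𝐌[h, 4 * R₁ + 4] := mass_nonneg h _
  have hJ0 : 0 ≤ 𝐉[h, Y] := farMass_nonneg h Y hY
  have hR2 : 0 < R₁ ^ 2 := by positivity
  have h1 : 𝐌[Δ[τ] h, R₁] ≤ (4 * (Cₐ / R₁ ^ 2 * 𝐌[h, 4 * R₁ + 4] + Cⱼ * 𝐉[h, Y])) / κ := by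
    rw [le_div_iff₀ hκ0, mul_comm]
    linarith
  have h2 : (4 * (Cₐ / R₁ ^ 2 * 𝐌[h, 4 * R₁ + 4] + Cⱼ * 𝐉[h, Y])) / κ =
      (4 * Cₐ / κ) * (𝐌[h, 4 * R₁ + 4] / R₁ ^ 2) + (4 * Cⱼ / κ) * 𝐉[h, Y] := by ring
  rw [h2] at h1
  have hM0' : 0 ≤ 𝐌[h, 4 * R₁ + 4] / R₁ ^ 2 := by positivity
  calc 𝐌[Δ[τ] h, R₁] ≤ (4 * Cₐ / κ) * (𝐌[h, 4 * R₁ + 4] / R₁ ^ 2) + (4 * Cⱼ / κ) * 𝐉[h, Y] := h1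
    _ ≤ 𝐋 * (𝐌[h, 4 * R₁ + 4] / R₁ ^ 2) + 𝐋 * 𝐉[h, Y] := by gcongr
    _ = 𝐋 * (𝐌[h, 4 * R₁ + 4] / R₁ ^ 2 + 𝐉[h, Y]) := by ring

/-! ## The pointwise bounds for gradient, second differences and cross differences -/

/-- The gradient far mass dominates each `J_Y(Δ_τ h)`. [folklore] -/
theorem farMass_le_farMassΔ {h : (EuclideanSpace ℝ (Fin 3)) → (EuclideanSpace ℝ (Fin 3))} {Y : ℝ} (hY : 0 < Y)
    {τ : EuclideanSpace ℝ (Fin 3)} (hτ : τ = 𝐮₁ ∨ τ = 𝐮₂ ∨ τ = 𝐰₃) : 𝐉[Δ[τ] h, Y] ≤ 𝐉Δ[h, Y] := by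
  have h1 := farMass_nonneg (t := t) (A := A) (c₀ := c₀) (Δ[𝐮₁] h) Y hY
  have h2 := farMass_nonneg (t := t) (A := A) (c₀ := c₀) (Δ[𝐮₂] h) Y hY
  have h3 := farMass_nonneg (t := t) (A := A) (c₀ := c₀) (Δ[𝐰₃] h) Y hY
  rcases hτ with rfl | rfl | rfl
  · linarith
  · linarith
  · linarith

/-- **Pointwise gradient bound**: for `x₀ ∈ S ∩ B_{r'}(c₀)`, `r' ≥ 2`, `R₁ = 1280r'+2388`, `ρ_h ≥ 2R₁+2`,
`‖Δ_τ h(x₀)‖² ≤ 64L³Γ/r'³ + 536L³r'³ JΔ`. [folklore] -/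
theorem sup_grad_sq_le (hA : Adm₀ A) (hI : Inner₀ t A) (hκ0 : 0 < κ)
    (hκ : ∀ v : (EuclideanSpace ℝ (Fin 3)) → (EuclideanSpace ℝ (Fin 3)), (Function.support v).Finite →
      Function.support v ⊆ Sites₀ t A → κ * nnForm t A v ≤ ∑' p : Sites₀ t A, ⟪𝕃 v @ p, v p⟫)
    {h : (EuclideanSpace ℝ (Fin 3)) → (EuclideanSpace ℝ (Fin 3))} (hh : (Function.support h).Finite)
    {r' : ℝ} (hr' : 2 ≤ r') {ρh : ℝ} (hρh : 2 * (1280 * r' + 2388) + 2 ≤ ρh)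
    {Gf : (EuclideanSpace ℝ (Fin 3)) → (EuclideanSpace ℝ (Fin 3))}
    (hG : ∀ (p : Sites₀ t A) (l : EuclideanSpace ℝ (Fin 3)), l ∈ Λ₀ → Gf ((p : EuclideanSpace ℝ (Fin 3)) + A l) = Gf p)
    (hrows : ∀ p : Sites₀ t A, dist (p : EuclideanSpace ℝ (Fin 3)) c₀ ≤ ρh → 𝕃 h @ p = Gf p)
    (hwork : 𝐖[Gf, h, 1280 * r' + 2388] ≤ 0) {τ : EuclideanSpace ℝ (Fin 3)} (hτ : τ = 𝐮₁ ∨ τ = 𝐮₂ ∨ τ = 𝐰₃)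
    {x₀ : EuclideanSpace ℝ (Fin 3)} (hx₀ : x₀ ∈ Sites₀ t A) (hxr : dist x₀ c₀ ≤ r') :
    ‖(Δ[τ] h) x₀‖ ^ 2 ≤
      64 * 𝐋 ^ 3 / r' ^ 3 * (𝐋 * (𝐌[h, 4 * (1280 * r' + 2388) + 4] / (1280 * r' + 2388) ^ 2 + 𝐉[h, 10 * r' + 10])) +
      536 * 𝐋 ^ 3 * r' ^ 3 * 𝐉Δ[h, 10 * r' + 10] := by
  obtain ⟨hτΛ, hτ2⟩ := gen_mem hA hτ
  have hY0 : (0 : ℝ) < 10 * r' + 10 := by linarith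
  have hg : (Function.support (Δ[τ] h)).Finite := finite_support_translate_sub hh (A τ)
  have hgharm := harm_diff_of_rows hA hI hh hτΛ hτ2 hG hrows
  have h1 := sup_sq_le_of_harmonic hA hI hκ0 hκ hg hr' (ρg := ρh - 2) (by linarith) hgharm hx₀ hxr
  have h2 := mass_grad_le hA hI hκ0 hκ hh (R₁ := 1280 * r' + 2388) (by linarith) (ρh := ρh) (by linarith) hrows hwork hτ
    hY0 (by linarith)
  have h3 : 𝐌[Δ[τ] h, 320 * r' + 340] ≤ 𝐌[Δ[τ] h, 1280 * r' + 2388] := mass_mono hA hI (Δ[τ] h) (by linarith)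
  have h4 := farMass_le_farMassΔ (t := t) (A := A) (c₀ := c₀) (h := h) hY0 hτ
  obtain ⟨hL1, -, -, -⟩ := levelConst_le (κ := κ) hκ0
  have hL0 : 0 ≤ 𝐋 := by linarith
  have hc1 : 0 ≤ 64 * 𝐋 ^ 3 / r' ^ 3 := by positivity
  have hc2 : 0 ≤ 536 * 𝐋 ^ 3 * r' ^ 3 := by positivity
  calc ‖(Δ[τ] h) x₀‖ ^ 2 ≤ 64 * 𝐋 ^ 3 / r' ^ 3 * 𝐌[Δ[τ] h, 320 * r' + 340] +
        536 * 𝐋 ^ 3 * r' ^ 3 * 𝐉[Δ[τ] h, 10 * r' + 10] := h1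
    _ ≤ _ := by gcongr; exact h3.trans h2

/-- Algebra of the second-difference bound. [folklore] -/
theorem hessAlg_eq {L r Γ J : ℝ} (hr : r ≠ 0) :
    64 * L ^ 3 / r ^ 3 * (L / r ^ 2 * Γ + L * J) + 536 * L ^ 3 * r ^ 3 * (6 * J) =
      64 * L ^ 4 / r ^ 5 * Γ + (64 * L ^ 4 / r ^ 3 + 3216 * L ^ 3 * r ^ 3) * J := by
  field_simp
  ring

/-- Scalar form of the second-difference bound. [folklore] -/
theorem hessAlg_le {L r Γ J : ℝ} (hL : 1 ≤ L) (hr : 0 < r) (hJ : 0 ≤ J) :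
    64 * L ^ 3 / r ^ 3 * (L / r ^ 2 * Γ + L * J) + 536 * L ^ 3 * r ^ 3 * (6 * J) ≤
      64 * L ^ 4 / r ^ 5 * Γ + (64 * L ^ 4 / r ^ 3 + 3216 * L ^ 4 * r ^ 3) * J := by
  rw [hessAlg_eq hr.ne']
  have hL0 : 0 ≤ L := by linarith
  have h7 : L ^ 3 ≤ L ^ 4 := by
    calc L ^ 3 = L ^ 3 * 1 := (mul_one _).symm
      _ ≤ L ^ 3 * L := by gcongr
      _ = L ^ 4 := by ring
  have h8 : 3216 * L ^ 3 * r ^ 3 * J ≤ 3216 * L ^ 4 * r ^ 3 * J := by gcongr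
  nlinarith [h8]

/-- Scalar form of the cross-difference bound. [folklore] -/
theorem crossAlg_le {L r Γ J : ℝ} (hL : 1 ≤ L) (hr : 0 < r) (hΓ : 0 ≤ Γ) (hJ : 0 ≤ J) :
    16 * L ^ 4 / r ^ 5 * Γ + 251 * L ^ 4 * r ^ 3 * J ≤
      64 * L ^ 4 / r ^ 5 * Γ + (64 * L ^ 4 / r ^ 3 + 3216 * L ^ 4 * r ^ 3) * J := by
  have hL0 : 0 ≤ L := by linarith
  have h1 : 16 * L ^ 4 / r ^ 5 * Γ ≤ 64 * L ^ 4 / r ^ 5 * Γ := by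
    apply mul_le_mul_of_nonneg_right _ hΓ
    apply div_le_div_of_nonneg_right _ (by positivity)
    nlinarith [pow_nonneg hL0 4]
  have h2 : 251 * L ^ 4 * r ^ 3 * J ≤ (64 * L ^ 4 / r ^ 3 + 3216 * L ^ 4 * r ^ 3) * J := by
    apply mul_le_mul_of_nonneg_right _ hJ
    have : 0 ≤ 64 * L ^ 4 / r ^ 3 := by positivity
    nlinarith [mul_nonneg (pow_nonneg hL0 4) (pow_nonneg hr.le 3)]
  linarith

/-- **Pointwise second-difference bound**: for `x₀ ∈ S ∩ B_{r'}(c₀)`, `r' ≥ 2`, `R₁ = 1280r'+2388`,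
`ρ_h ≥ 2R₁+4`: `‖Δ_σΔ_τ h(x₀)‖² ≤ 64L⁴Γ/r'⁵ + (64L⁴/r'³ + 3216L⁴r'³) JΔ`. [folklore] -/
theorem sup_hess_sq_le (hA : Adm₀ A) (hI : Inner₀ t A) (hκ0 : 0 < κ)
    (hκ : ∀ v : (EuclideanSpace ℝ (Fin 3)) → (EuclideanSpace ℝ (Fin 3)), (Function.support v).Finite →
      Function.support v ⊆ Sites₀ t A → κ * nnForm t A v ≤ ∑' p : Sites₀ t A, ⟪𝕃 v @ p, v p⟫)
    {h : (EuclideanSpace ℝ (Fin 3)) → (EuclideanSpace ℝ (Fin 3))} (hh : (Function.support h).Finite)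
    {r' : ℝ} (hr' : 2 ≤ r') {ρh : ℝ} (hρh : 2 * (1280 * r' + 2388) + 4 ≤ ρh)
    {Gf : (EuclideanSpace ℝ (Fin 3)) → (EuclideanSpace ℝ (Fin 3))}
    (hG : ∀ (p : Sites₀ t A) (l : EuclideanSpace ℝ (Fin 3)), l ∈ Λ₀ → Gf ((p : EuclideanSpace ℝ (Fin 3)) + A l) = Gf p)
    (hrows : ∀ p : Sites₀ t A, dist (p : EuclideanSpace ℝ (Fin 3)) c₀ ≤ ρh → 𝕃 h @ p = Gf p)
    (hwork : 𝐖[Gf, h, 1280 * r' + 2388] ≤ 0)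
    {σ τ : EuclideanSpace ℝ (Fin 3)} (hσ : σ = 𝐮₁ ∨ σ = 𝐮₂ ∨ σ = 𝐰₃) (hτ : τ = 𝐮₁ ∨ τ = 𝐮₂ ∨ τ = 𝐰₃)
    {x₀ : EuclideanSpace ℝ (Fin 3)} (hx₀ : x₀ ∈ Sites₀ t A) (hxr : dist x₀ c₀ ≤ r') :
    ‖(Δ[σ] (Δ[τ] h)) x₀‖ ^ 2 ≤
      64 * 𝐋 ^ 4 / r' ^ 5 * (𝐋 * (𝐌[h, 4 * (1280 * r' + 2388) + 4] / (1280 * r' + 2388) ^ 2 + 𝐉[h, 10 * r' + 10])) +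
      (64 * 𝐋 ^ 4 / r' ^ 3 + 3216 * 𝐋 ^ 4 * r' ^ 3) * 𝐉Δ[h, 10 * r' + 10] := by
  obtain ⟨hτΛ, hτ2⟩ := gen_mem hA hτ
  obtain ⟨hσΛ, hσ2⟩ := gen_mem hA hσ
  have hr0 : 0 < r' := by linarith
  have hY0 : (0 : ℝ) < 10 * r' + 10 := by linarith
  have hY25 : (25 : ℝ) ≤ 10 * r' + 10 := by linarith
  have hg1 : (Function.support (Δ[τ] h)).Finite := finite_support_translate_sub hh (A τ)
  have hg2 : (Function.support (Δ[σ] (Δ[τ] h))).Finite := finite_support_translate_sub hg1 (A σ)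
  have hg1harm := harm_diff_of_rows hA hI hh hτΛ hτ2 hG hrows
  have hg2harm := harm_diff hA hI hg1 hσΛ hσ2 hg1harm
  have h1 := sup_sq_le_of_harmonic hA hI hκ0 hκ hg2 hr' (ρg := ρh - 2 - 2) (by linarith) hg2harm hx₀ hxr
  have h2 := mass_diff_le₁ hA hI hκ0 hκ hg1 (X := 320 * r' + 340) (by linarith) (ρg := ρh - 2) (by linarith) hg1harm hσ
    hY0 (by linarith)
  have h3 := mass_grad_le hA hI hκ0 hκ hh (R₁ := 1280 * r' + 2388) (by linarith) (ρh := ρh) (by linarith) hrows hwork hτ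
    hY0 (by linarith)
  have h4 : 𝐌[Δ[τ] h, 4 * (320 * r' + 340) + 4] ≤ 𝐌[Δ[τ] h, 1280 * r' + 2388] := mass_mono hA hI (Δ[τ] h) (by linarith)
  have h5 := farMass_diff_le (t := t) (A := A) (c₀ := c₀) hg1 hσΛ hσ2 hY25
  have h6 := farMass_le_farMassΔ (t := t) (A := A) (c₀ := c₀) (h := h) hY0 hτ
  obtain ⟨hL1, -, -, -⟩ := levelConst_le (κ := κ) hκ0
  have hL0 : 0 ≤ 𝐋 := by linarith
  set Γ := 𝐋 * (𝐌[h, 4 * (1280 * r' + 2388) + 4] / (1280 * r' + 2388) ^ 2 + 𝐉[h, 10 * r' + 10]) with hΓ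
  set JD := 𝐉Δ[h, 10 * r' + 10] with hJD
  have hM0 : 0 ≤ 𝐌[h, 4 * (1280 * r' + 2388) + 4] := mass_nonneg h _
  have hJ0 : 0 ≤ 𝐉[h, 10 * r' + 10] := farMass_nonneg h _ hY0
  have hΓ0 : 0 ≤ Γ := by positivity
  have hJτ0 : 0 ≤ 𝐉[Δ[τ] h, 10 * r' + 10] := farMass_nonneg (Δ[τ] h) _ hY0
  have hJD0 : 0 ≤ JD := le_trans hJτ0 h6
  -- the mass of the second difference
  have hm : 𝐌[Δ[σ] (Δ[τ] h), 320 * r' + 340] ≤ 𝐋 / r' ^ 2 * Γ + 𝐋 * JD := by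
    have hfr : 𝐋 / (320 * r' + 340) ^ 2 ≤ 𝐋 / r' ^ 2 :=
      div_le_div_of_nonneg_left hL0 (by positivity) (pow_le_pow_left₀ hr0.le (by linarith) 2)
    have hmm : 𝐌[Δ[τ] h, 4 * (320 * r' + 340) + 4] ≤ Γ := h4.trans h3
    have hmm0 : 0 ≤ 𝐌[Δ[τ] h, 4 * (320 * r' + 340) + 4] := mass_nonneg (Δ[τ] h) _
    calc 𝐌[Δ[σ] (Δ[τ] h), 320 * r' + 340]
        ≤ 𝐋 / (320 * r' + 340) ^ 2 * 𝐌[Δ[τ] h, 4 * (320 * r' + 340) + 4] + 𝐋 * 𝐉[Δ[τ] h, 10 * r' + 10] := h2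
      _ ≤ 𝐋 / r' ^ 2 * Γ + 𝐋 * JD := by gcongr
  have hj : 𝐉[Δ[σ] (Δ[τ] h), 10 * r' + 10] ≤ 6 * JD := h5.trans (by linarith)
  have hm0 : 0 ≤ 𝐌[Δ[σ] (Δ[τ] h), 320 * r' + 340] := mass_nonneg (Δ[σ] (Δ[τ] h)) _
  have hj0 : 0 ≤ 𝐉[Δ[σ] (Δ[τ] h), 10 * r' + 10] := farMass_nonneg (Δ[σ] (Δ[τ] h)) _ hY0
  calc ‖(Δ[σ] (Δ[τ] h)) x₀‖ ^ 2
      ≤ 64 * 𝐋 ^ 3 / r' ^ 3 * 𝐌[Δ[σ] (Δ[τ] h), 320 * r' + 340] +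
        536 * 𝐋 ^ 3 * r' ^ 3 * 𝐉[Δ[σ] (Δ[τ] h), 10 * r' + 10] := h1
    _ ≤ 64 * 𝐋 ^ 3 / r' ^ 3 * (𝐋 / r' ^ 2 * Γ + 𝐋 * JD) + 536 * 𝐋 ^ 3 * r' ^ 3 * (6 * JD) := by gcongr
    _ ≤ _ := hessAlg_le hL1 hr0 hJD0

/-- **Pointwise cross-difference bound**: for `x₀ ∈ S₀ ∩ B_{r'}(c₀)`, `r' ≥ 2`, `R₁ = 1280r'+2388`, `ρ_h ≥ 2R₁+2`:
`‖Δ_τ h(x₀) − Δ_τ h(x₀ + (t 1 − t 0))‖² ≤ 64L⁴Γ/r'⁵ + (64L⁴/r'³ + 3216L⁴r'³) JΔ`. [folklore] -/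
theorem sup_cross_sq_le (hA : Adm₀ A) (hI : Inner₀ t A) (hκ0 : 0 < κ)
    (hκ : ∀ v : (EuclideanSpace ℝ (Fin 3)) → (EuclideanSpace ℝ (Fin 3)), (Function.support v).Finite →
      Function.support v ⊆ Sites₀ t A → κ * nnForm t A v ≤ ∑' p : Sites₀ t A, ⟪𝕃 v @ p, v p⟫)
    {h : (EuclideanSpace ℝ (Fin 3)) → (EuclideanSpace ℝ (Fin 3))} (hh : (Function.support h).Finite)
    {r' : ℝ} (hr' : 2 ≤ r') {ρh : ℝ} (hρh : 2 * (1280 * r' + 2388) + 2 ≤ ρh)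
    {Gf : (EuclideanSpace ℝ (Fin 3)) → (EuclideanSpace ℝ (Fin 3))}
    (hG : ∀ (p : Sites₀ t A) (l : EuclideanSpace ℝ (Fin 3)), l ∈ Λ₀ → Gf ((p : EuclideanSpace ℝ (Fin 3)) + A l) = Gf p)
    (hrows : ∀ p : Sites₀ t A, dist (p : EuclideanSpace ℝ (Fin 3)) c₀ ≤ ρh → 𝕃 h @ p = Gf p)
    (hwork : 𝐖[Gf, h, 1280 * r' + 2388] ≤ 0) {τ : EuclideanSpace ℝ (Fin 3)} (hτ : τ = 𝐮₁ ∨ τ = 𝐮₂ ∨ τ = 𝐰₃)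
    {x₀ : EuclideanSpace ℝ (Fin 3)} (hx₀ : ∃ z ∈ Λ₀, x₀ = t 0 + A z) (hxr : dist x₀ c₀ ≤ r') :
    ‖(Δ[τ] h) x₀ - (Δ[τ] h) (x₀ + (t 1 - t 0))‖ ^ 2 ≤
      64 * 𝐋 ^ 4 / r' ^ 5 * (𝐋 * (𝐌[h, 4 * (1280 * r' + 2388) + 4] / (1280 * r' + 2388) ^ 2 + 𝐉[h, 10 * r' + 10])) +
      (64 * 𝐋 ^ 4 / r' ^ 3 + 3216 * 𝐋 ^ 4 * r' ^ 3) * 𝐉Δ[h, 10 * r' + 10] := by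
  obtain ⟨hτΛ, hτ2⟩ := gen_mem hA hτ
  have hr0 : 0 < r' := by linarith
  have hY0 : (0 : ℝ) < 10 * r' + 10 := by linarith
  have hg1 : (Function.support (Δ[τ] h)).Finite := finite_support_translate_sub hh (A τ)
  have hg1harm := harm_diff_of_rows hA hI hh hτΛ hτ2 hG hrows
  have h1 := cross_sup_sq_le_of_harmonic hA hI hκ0 hκ hg1 hr' (ρg := ρh - 2) (by linarith) hg1harm hx₀ hxr
  have h3 := mass_grad_le hA hI hκ0 hκ hh (R₁ := 1280 * r' + 2388) (by linarith) (ρh := ρh) (by linarith) hrows hwork hτ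
    hY0 (by linarith)
  have h6 := farMass_le_farMassΔ (t := t) (A := A) (c₀ := c₀) (h := h) hY0 hτ
  obtain ⟨hL1, -, -, -⟩ := levelConst_le (κ := κ) hκ0
  have hL0 : 0 ≤ 𝐋 := by linarith
  set Γ := 𝐋 * (𝐌[h, 4 * (1280 * r' + 2388) + 4] / (1280 * r' + 2388) ^ 2 + 𝐉[h, 10 * r' + 10]) with hΓ
  set JD := 𝐉Δ[h, 10 * r' + 10] with hJD
  have hM0 : 0 ≤ 𝐌[h, 4 * (1280 * r' + 2388) + 4] := mass_nonneg h _
  have hJ0 : 0 ≤ 𝐉[h, 10 * r' + 10] := farMass_nonneg h _ hY0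
  have hΓ0 : 0 ≤ Γ := by positivity
  have hJτ0 : 0 ≤ 𝐉[Δ[τ] h, 10 * r' + 10] := farMass_nonneg (Δ[τ] h) _ hY0
  have hJD0 : 0 ≤ JD := le_trans hJτ0 h6
  have hm0 : 0 ≤ 𝐌[Δ[τ] h, 1280 * r' + 2388] := mass_nonneg (Δ[τ] h) _
  calc ‖(Δ[τ] h) x₀ - (Δ[τ] h) (x₀ + (t 1 - t 0))‖ ^ 2
      ≤ 16 * 𝐋 ^ 4 / r' ^ 5 * 𝐌[Δ[τ] h, 1280 * r' + 2388] + 251 * 𝐋 ^ 4 * r' ^ 3 * 𝐉[Δ[τ] h, 10 * r' + 10] := h1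
    _ ≤ 16 * 𝐋 ^ 4 / r' ^ 5 * Γ + 251 * 𝐋 ^ 4 * r' ^ 3 * JD := by gcongr
    _ ≤ _ := crossAlg_le hL1 hr0 hΓ0 hJD0

end

end Summit.AtomisticToContinuum.Crystallization.Theorems.ExcessDecayLiouville

end
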